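import Summits.QuantumFields.YangMills.Theorems.BalabanUVNodesN18AtRateRecord13RunTowersGenBelow
import Summits.QuantumFields.YangMills.Theorems.BalabanUVNodesN18HLayerW1TermInputs226Chain
import Literature.MathematicalPhysics.QuantumFieldTheory.Balaban1983to89.Node00.HistoryTermIndexedGeneratorTotal

/-!
# BalabanUVNodes ∕ node N18 = NE5 — N18 AT node U3's STAGE-13 BUNDLE FOR THE RUN TOWERS GENERATED BY A (2.14) TERM-DATUM FAMILY OF RECORD, FROM THE END's DATA
# AND ONE TABLE-BASED LOCATED-INPUTS RECORD PER LEVEL (the s1 ∘ s2 junction at the datum: dag-n18-d's module 18g §2 at `G k := (𝔇 k).Gn` ∕ `(𝔇 k).Gn₀`, its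
# hypothesis (ii) PRODUCED by file 32 `stepGen_Gn_of_inputs226Holo`; Track A, DAG node N18 = `T4OutputRate.NE5 EA EB W κ θ C₅` :211; cluster K4 «SpineRates»;
# file 33 of seat pub-ymgap-dag-n18-c, row s1, generation 15)

Cell `pub-ymgap`, HUMAN RULING D-0062 (Track A), R134 ACCELERATION seat `pub-ymgap-dag-n18-c` (strategy s1 «the H-layer ACTIVITY DATUM on the record's torus
catalogue: instance + estimate»), generation 15.  THEOREMS ONLY (no `def`, no `instance`, no `sorry`); imports dag-n18-d's module 18g
`…N18AtRateRecord13RunTowersGenBelow` (§2 `n18At_u3OfRecord₁₃_readingAdm_runTowers_toClusterTower_of_stepGen_lt`), this seat's file 32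
`…N18HLayerW1TermInputs226Chain` (`stepGen_Gn_of_inputs226Holo`) and node00-def-W1's W1-9 `Node00/HistoryTermIndexedGeneratorTotal` (`TermData214.Gn₀`,
`Gn₀_eq`) BY NAME; restates nothing.  θ-LEVEL (per Stage-13 tuple and run length): NO record key (‴ ∕ `Sep` ∕ `Co` ∕ `CoP`) is touched.

WHY.  dag-n18-d's row s2 closed (bus 2026-08-27 10:04Z) naming N18's residual (ii) «NODE A located inputs at the (2.14) datum (n18-c files 25–30 — plug into 18g
§2 (ii) at `G k := (𝔇 k).Gn` by hand)»; dag-n22-c's R2c `…N22W1RelCentredTermDatum214Generated` (and its `Co` twin) READ node N18 below `ksel` as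
`h18 : … ∀ k' < ksel …, N18At (u3OfRecord₁₃ θ ((ReadingData.ofRecordAdm F θ.τ9.M N (runTowers fun k ↦ toClusterTower ((𝔇 F θ k).Gn₀)) (sp F θ) …).u3Objects θ.γ) k')`.
THIS FILE is that plug as a theorem: module 18g §2's junction at the generator family `G k := (𝔇 k).Gn` (positive cube size) and at W1-9's total generator
`G k := (𝔇 k).Gn₀` (`= Gn`, `Gn₀_eq`), with hypothesis (ii) — (GEN) for both runs' generators on their tables — PRODUCED per level by file 32's
`stepGen_Gn_of_inputs226Holo` from ONE table-based located-inputs record of W1's STOREY 8 (`(𝔇 k m).Inputs226Holo (c k) Z t s old φ₁ a a₅` at every point of an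
open located-inputs table `big k (m+1) Z ⊇ sp k (m+1) Z`; file 31 inhabits it per term from NODE A's walk record) and [II] Lemma 3's socket numerals of an estimate
record `c k` (datum constants `c₀ k` may differ); the record's (2.38) amplitude `C₃ε₁` and rate `(1−8δ)·½L·κ` are DOMINATED into THE END's letters `A_A ∕ A_B`, `R_d`
(`norm_le_of_le_amplitude_rate`), so module 18g's block (i) is carried VERBATIM.

WHAT (theorems only).
* `norm_le_of_le_amplitude_rate` — `a·e^{−R·d} ≤ A·e^{−R_d·d}` for `0 ≤ a ≤ A`, `R_d ≤ R`, `0 ≤ d` (the domination step).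
* ★ `n18At_u3OfRecord₁₃_readingAdm_runTowers_Gn_of_inputs226Holo` — ONE Stage-13 tuple `θ` (positive cube size `θ.τ9.M`), ONE run length `k`: THE END's data
  (i) over the carriers of the admissible level pairing (functionals of the run towers generated by `k ↦ (𝔇 k).Gn`; module 18 §1's (i) VERBATIM) ∧ (ii-A)∕(ii-B)
  the table-based located-inputs records + socket numerals + domination at levels `k` and `k + 1` ∧ `]0, γ′] ⊆ D` ∧ the letters dominate ⟹
  `N18At (u3OfRecord₁₃ θ ((ReadingData.ofRecordAdm F θ.τ9.M N (runTowers fun k ↦ toClusterTower ((𝔇 k).Gn)) sp gauge hg T₀ hT₀ li).u3Objects θ.γ) k)`.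
* ★ `n18At_u3OfRecord₁₃_readingAdm_runTowers_Gn₀_of_inputs226Holo` — the same at W1-9's TOTAL generator `k ↦ (𝔇 k).Gn₀` (dag-n22-c R2c's `h18` shape per
  `k' < ksel`), by `TermData214.Gn₀_apply_eq` under the tuple's `NeZero θ.τ9.M`.

HONEST FRAMING — what this is NOT.  Count-neutral by-name knit (`--supports`, helper); NO estimate of Bałaban's is proved here: THE END's data (i) (step models
representing (2.13), THE NODE-A MAJORANT, leaves L01–L03 ∕ L07–L10 — rows NE2 ∕ NE3, NODE O), the located-inputs records `hloc` (NODE A's kernel records, LEMMA 2 along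
the history, (2.22)), the numerals and the term-datum family `𝔇` (DATA — node 00's datum of record is not yet typed from def-B13's kernels) are HYPOTHESES ∕
PARAMETERS; no inhabitant of `IsDatumOfRecord₁₃C…` ∕ admissible tuple is claimed (K0 OPEN); vacuous where a table is empty.  NOT a discharge of N18 (typed 28∕28 ·
discharged 5∕27 UNCHANGED); NE5 is NOT IN PRINT ([I] Thm 1 p. 259 is the printed statement it serves) and NOT PROVED.  One finite four-torus programme at fixed `ε`,
Bałaban as printed — NOT ℝ⁴, NOT infinite volume, NOT OS, NOT a mass gap, NOT Clay.  0 `sorry`, 0 `def`.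

References (TYPES ∕ loci only): [I] = [Balaban1987RG1] CMP **109** (1987) — (0.23)–(0.25) pp. 256–257, Thm 1 p. 259, (1.18) p. 263, (2.12)–(2.13) p. 268;
[II] = [Balaban1988RG2Cluster] CMP **116** (1988) — (1.41) p. 11, (2.9)–(2.11) p. 14, (2.13)–(2.15) pp. 14–15, (2.16)–(2.26) pp. 16–17, Lemma 3 (2.38) p. 20,
(2.41) p. 21, p. 22; [KP86] = [KoteckyPreiss1986]; [Chae1985] Thm 14.13.
-/

noncomputable section

open scoped Classical
open scoped Matrix.Norms.L2Operator

namespace Summit.QuantumFields.YangMills.BalabanUVNodes.N18AtTermDatumInputs226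

open Set Metric
open scoped BigOperators Matrix
open Literature.MathematicalPhysics.QuantumFieldTheory.Balaban1983to89
open Literature.MathematicalPhysics.QuantumFieldTheory.Balaban1983to89.T4Continuum
open Literature.MathematicalPhysics.QuantumFieldTheory.Balaban1983to89.T4OutputRate (Carriers Functional NE5 DecayBound Window)
open Literature.MathematicalPhysics.QuantumFieldTheory.Balaban1983to89.T4InputCauchyRateData (StepModel)
open Literature.MathematicalPhysics.QuantumFieldTheory.Balaban1983to89.B13Resummation (locE)
open Literature.MathematicalPhysics.QuantumFieldTheory.Balaban1983to89.TreeLengthTorus (TDom TPt tsys torusTreeLen)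
open Literature.MathematicalPhysics.QuantumFieldTheory.Balaban1983to89.TreeLengthTorusGeometry (TTouch)
open Literature.MathematicalPhysics.QuantumFieldTheory.Balaban1983to89.B12TreeDecay (K₀)
open Literature.MathematicalPhysics.QuantumFieldTheory.Balaban1983to89.B13Lemma3TorusTerms (terms)
open Literature.MathematicalPhysics.QuantumFieldTheory.Balaban1983to89.B9Thm37GlueTorus (tdist1)
open Literature.MathematicalPhysics.QuantumFieldTheory.Balaban1983to89.B13Lemma3TorusSocket (Lemma3Numerics)
open Literature.MathematicalPhysics.QuantumFieldTheory.Balaban1983to89.Node00 (Stage12Params Stage13Params U3Letters₁₁ U3Objects₁₁ MatA ιSU)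
open Literature.MathematicalPhysics.QuantumFieldTheory.Balaban1983to89.Node00.Sect2 (domCount domSys CPair ofBackgroundC)
open Literature.MathematicalPhysics.QuantumFieldTheory.Balaban1983to89.Node00.W1
open Summit.QuantumFields.BalabanUV.T4Continuum.Spine.NE5
open Summit.QuantumFields.YangMills.BalabanUVNodes.N18HLayerW1TermInputs226Chain (stepGen_Gn_of_inputs226Holo)
open YMDAG.N18.HLayer
open YMDAG.N18.W1Reading (n18At_u3OfRecord₁₃_readingAdm_runTowers_toClusterTower_of_stepGen_lt)
open YMDAG.UVSplit

/-! ## §0 The domination step -/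

/-- **DOMINATION OF AN EXPONENTIAL MAJORANT INTO LARGER LETTERS** [bookkeeping]: `a·e^{−R·d} ≤ A·e^{−R_d·d}` whenever `0 ≤ a ≤ A`, `R_d ≤ R` and `0 ≤ d` — how the
record's (2.38) amplitude `C₃ε₁` and rate `(1−8δ)·½L·κ` are read at THE END's letters. [cite: Balaban1988RG2Cluster, Lemma 3 (2.38) p.20 (bookkeeping)] -/
theorem norm_le_of_le_amplitude_rate {x a A R Rd d : ℝ} (hx : x ≤ a * Real.exp (-(R * d))) (ha : 0 ≤ a) (haA : a ≤ A) (hR : Rd ≤ R)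
    (hd : 0 ≤ d) : x ≤ A * Real.exp (-(Rd * d)) :=
  hx.trans (mul_le_mul haA (Real.exp_le_exp.2 (neg_le_neg (mul_le_mul_of_nonneg_right hR hd))) (Real.exp_nonneg _) (ha.trans haA))

variable {N : ℕ} [NeZero N]

/-! ## §1 One Stage-13 tuple, one run length: N18 at the run towers generated by the term-datum family, from THE END's data + the located records -/

section Level

variable {F : T4Family} (θ : Stage13Params F N) [NeZero θ.τ9.M] (k : ℕ)
  {c₀ : ℕ → B13.Consts} (c : ℕ → B13.Consts) (L : ℕ → ℕ) [∀ k, NeZero (L k)]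
  (𝔇 : (k : ℕ) → TermData214 (c₀ k) (F.P k) (MatA N) θ.τ9.M (L k)) (D : Set ℂ)
  (sp big : (k j : ℕ) → (domSys (F.P k) θ.τ9.M j).Dom → Set (CPair (F.P k) (MatA N)))
  (gauge : (k : ℕ) → GaugeField (F.P k) 0 (Node00.SU N) → GaugeField (F.P k) 0 (Node00.SU N) → ℝ) (hg : ∀ k U U', 0 ≤ gauge k U U')
  (T₀ : (k : ℕ) → GaugeField (F.P (k + 1)) 0 (Node00.SU N) → GaugeField (F.P k) 0 (Node00.SU N))
  (hT₀ : ∀ (k : ℕ) (U : GaugeField (F.P (k + 1)) 0 (Node00.SU N)),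
    (∀ (j : ℕ) (Y : (domSys (F.P (k + 1)) θ.τ9.M j).Dom), ofBackgroundC (ιSU N) U ∈ sp (k + 1) j Y) →
      ∀ (j : ℕ) (X : (domSys (F.P k) θ.τ9.M j).Dom), ofBackgroundC (ιSU N) (T₀ k U) ∈ sp k j X)
  (li : LetterInputs)

open Classical in
/-- ★ **N18 AT node U3's STAGE-13 BUNDLE FOR THE RUN TOWERS GENERATED BY A (2.14) TERM-DATUM FAMILY, ONE TUPLE AND ONE RUN LENGTH, FROM THE END's DATA AND
ONE TABLE-BASED LOCATED-INPUTS RECORD PER LEVEL** [bookkeeping; dag-n18-d's module 18g §2 `n18At_u3OfRecord₁₃_readingAdm_runTowers_toClusterTower_of_stepGen_lt`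
at `G k := (𝔇 k).Gn`, its hypothesis (ii) — (GEN) for both runs' generators on their tables — PRODUCED per level by file 32's `stepGen_Gn_of_inputs226Holo` and
dominated into THE END's letters by `norm_le_of_le_amplitude_rate`]: for the objects of
`ReadingData.ofRecordAdm F θ.τ9.M N (runTowers (k ↦ toClusterTower ((𝔇 k).Gn))) sp gauge hg T₀ hT₀ li` at a tuple with positive cube size: (i) THE END's data over
the carriers of the admissible level pairing at level `k` (per-member step models `Mb b` representing (2.13) with THE NODE-A MAJORANT AS HYPOTHESIS, L01–L03 on
the generated run towers' functionals, rows NE2 ∕ NE3's L07 ∕ L08, the W3 shapes, numerals, L10, sharp clause — module 18 §1's (i) VERBATIM), and, at each of the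
levels `k` (class letter `E_A`, END amplitude `A_A`) and `k + 1` (`E_B`, `A_B`): (ii) restriction-closed tables `sp` inside OPEN located-inputs tables `big`,
[II] Lemma 3's socket numerals of the estimate record `c`, for every step `m`, every `s ∈ D`, every older-term table in the class «(1.18)`(E,κ)` on the tables +
analytic there», every `Z`, every term `t ∈ terms (L ·) θ.τ9.M Z` and every point `φ₁` of `big · (m+1) Z` a record `(𝔇 · m).Inputs226Holo (c ·) Z t s old φ₁ a a₅`
of W1's STOREY 8 with its eleven configuration fields on the table and the three joint-holomorphy letters (file 32's `hloc`), and the domination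
`0 ≤ C₃ε₁ ≤ A`, `R_d ≤ (1−8δ)·½L·κ` with the STRICT [KP86] clause and the renewal at `A`; (iii) `]0, γ′] ⊆ D` and the letters `li` dominate ⟹ `N18At` at node
U3's Stage-13 bundle of level `k`.  NOT a discharge of N18; every datum is a hypothesis.
[cite: Balaban1987RG1, (0.23)–(0.25) pp.256–257, Thm 1 p.259, (1.18) p.263 and (2.12)–(2.13) p.268; Balaban1988RG2Cluster, (1.41) p.11, (2.13)–(2.15) pp.14–15, (2.26) p.17, Lemma 3 (2.38) p.20] -/
theorem n18At_u3OfRecord₁₃_readingAdm_runTowers_Gn_of_inputs226Holo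
    (h : ∃ (Op : Type) (_ : NormedAddCommGroup Op) (_ : NormedSpace ℂ Op) (Hist : Type) (_ : NormedAddCommGroup Hist) (_ : NormedSpace ℂ Hist)
        (Mb : ℝ → StepModel (LevelPairing.ofRecordAdm F θ.τ9.M N k sp (gauge k) (hg k) (T₀ k) (hT₀ k)).carriers Op Hist)
        (act : ℝ → (j : ℕ) → Op × Hist → TDom 4 (domCount (F.P k) θ.τ9.M j) → ℂ) (γ' C3 ε₁ Rd κ A_A A_B E_A E_B E₁ δ δ' θr θ' cH ω ρ₀ B : ℝ) (k₀ : ℕ)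
        (aA a₂A a₂A' a₅A AabsA aB a₂B a₂B' a₅B AabsB : ℝ),
        -- (i) THE END's data over the carriers of the admissible level pairing, functionals OF THE GENERATED RUN TOWERS (module 18 §1's (i) verbatim)
        (∀ b : ℝ, 0 < b → b ≤ γ' → ∀ (X : Node00.W1.Dom (F.P k) θ.τ9.M) (z : Op × Hist),
          (Mb b).Out X.1 z.1 z.2 X =
            locE (TTouch (d := 4) (N := domCount (F.P k) θ.τ9.M X.1)) (fun Z : (tsys 4 (domCount (F.P k) θ.τ9.M X.1)).Dom => Z.1)
              (act b X.1 z) X.2.1) ∧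
        0 ≤ C3 ∧ 0 ≤ ε₁ ∧ 0 ≤ κ ∧ κ + 2 * (64 * Real.log 162) + 2 ≤ Rd ∧
        C3 * ε₁ * Real.exp (5 * κ + 1) * K₀ 64 8 * 9 * 64 ≤ 1 ∧
        (∀ b : ℝ, 0 < b → b ≤ γ' → ∀ j, ∀ g ∈ Window γ',
          ∀ (U : (LevelPairing.ofRecordAdm F θ.τ9.M N k sp (gauge k) (hg k) (T₀ k) (hT₀ k)).BgB) (q : Op × Hist), q ∈ (Mb b).Base j g U →
          ∃ V : Set (Op × Hist), IsOpen V ∧ (Mb b).box j q ⊆ V ∧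
            (∀ Z : TDom 4 (domCount (F.P k) θ.τ9.M j), DifferentiableOn ℂ (fun z : Op × Hist => act b j z Z) V) ∧
            (∀ z ∈ V, ∀ Z : TDom 4 (domCount (F.P k) θ.τ9.M j), ‖act b j z Z‖ ≤ C3 * ε₁ * Real.exp (-(Rd * torusTreeLen Z.1)))) ∧
        (∀ b : ℝ, 0 < b → b ≤ γ' → L01 (Mb b)
          ((LevelPairing.ofRecordAdm F θ.τ9.M N k sp (gauge k) (hg k) (T₀ k) (hT₀ k)).EA (runTowers (fun k => toClusterTower ((𝔇 k).Gn)) k)) (Window γ')) ∧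
        (∀ b : ℝ, 0 < b → b ≤ γ' → L02 (Mb b)
          ((LevelPairing.ofRecordAdm F θ.τ9.M N k sp (gauge k) (hg k) (T₀ k) (hT₀ k)).EB (runTowers (fun k => toClusterTower ((𝔇 k).Gn)) (k + 1)) b) (Window γ')) ∧
        (∀ b : ℝ, 0 < b → b ≤ γ' → L03 (Mb b)
          ((LevelPairing.ofRecordAdm F θ.τ9.M N k sp (gauge k) (hg k) (T₀ k) (hT₀ k)).EB (runTowers (fun k => toClusterTower ((𝔇 k).Gn)) (k + 1)) b) (Window γ')) ∧
        (∀ b : ℝ, 0 < b → b ≤ γ' → L07 (Mb b) (Window γ') δ θr) ∧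
        (∀ b : ℝ, 0 < b → b ≤ γ' → L08 (Mb b) (Window γ') κ (Real.exp 1 * 9 * 64 * K₀ 64 8 ^ 2 * A_B) δ' θr) ∧
        (∀ b : ℝ, 0 < b → b ≤ γ' → L09aff (Mb b) (Window γ')) ∧ (∀ b : ℝ, 0 < b → b ≤ γ' → L09blind (Mb b) (Window γ')) ∧
        (∀ b : ℝ, 0 < b → b ≤ γ' → L09hom (Mb b) (Window γ')) ∧ (∀ b : ℝ, 0 < b → b ≤ γ' → L09unit (Mb b) (Window γ') κ E₁ cH ω) ∧
        0 < E₁ ∧ 0 ≤ δ + δ' ∧ 0 ≤ θr ∧ θr ≤ θ' ∧ θ' ≤ 1 ∧ 0 ≤ cH ∧ 0 < ω ∧ ρ₀ < 1 ∧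
        (δ + δ') * θr ^ k₀ +
            cH * (Real.exp 1 * 9 * 64 * K₀ 64 8 ^ 2 * A_A + Real.exp 1 * 9 * 64 * K₀ 64 8 ^ 2 * A_B) / (1 - ω) ≤ ρ₀ ∧
        0 ≤ B ∧ (∀ k < k₀, Real.exp 1 * 9 * 64 * K₀ 64 8 ^ 2 * A_A + Real.exp 1 * 9 * 64 * K₀ 64 8 ^ 2 * A_B ≤ B * θr ^ k) ∧
        Real.exp 1 * 9 * 64 * K₀ 64 8 ^ 2 * C3 * cH * ε₁ < (θ' - ω) * (1 - ρ₀) ∧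
        -- (ii-A) level `k`: tables ⊆ OPEN located-inputs tables, socket numerals of `c k`, ONE located-inputs record per table point (file 32's `hloc`), domination
        (∀ m, SpRestr (sp k (m + 1))) ∧
        (∀ (m : ℕ) (Z : (domSys (F.P k) θ.τ9.M (m + 1)).Dom), IsOpen (big k (m + 1) Z)) ∧
        (∀ (m : ℕ) (Z : (domSys (F.P k) θ.τ9.M (m + 1)).Dom), sp k (m + 1) Z ⊆ big k (m + 1) Z) ∧
        1 ≤ (c k).κ₁ ∧ (c k).α₆ ≠ 0 ∧ 8 ≤ (c k).L ∧ (c k).L = L k ∧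
        Lemma3Numerics (c k) θ.τ9.M (((c k).L : ℝ) / 2) aA a₂A a₂A' a₅A AabsA ∧
        (∀ m : ℕ, ∀ s ∈ D, ∀ old : OlderTerms (F.P k) (MatA N) θ.τ9.M m,
          (∀ (j : Fin (m + 1)) (Y : (domSys (F.P k) θ.τ9.M j).Dom), ∀ ψ ∈ sp k j Y, ‖old j Y ψ‖ ≤ E_A * Real.exp (-(κ * (domSys (F.P k) θ.τ9.M j).dj Y))) →
          (∀ (j : Fin (m + 1)) (Y : (domSys (F.P k) θ.τ9.M j).Dom), AnalyticOnNhd ℂ (old j Y) (sp k j Y)) →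
          ∀ (Z : (domSys (F.P k) θ.τ9.M (m + 1)).Dom), ∀ t ∈ terms (L k) θ.τ9.M Z, ∀ φ₁ ∈ big k (m + 1) Z,
            ∃ ι : (𝔇 k m).Inputs226Holo (c k) Z t s old φ₁ aA a₅A,
            (∀ φ ∈ big k (m + 1) Z, ∀ i j, DifferentiableOn ℂ (fun σ => (𝔇 k m).A Z t φ σ i j) {σ | ∀ j, σ j ∈ ι.Uσ}) ∧
            (∀ φ ∈ big k (m + 1) Z, ∀ i j, DifferentiableOn ℂ (fun σ => ((𝔇 k m).𝒦 Z t).G2 σ ((𝔇 k m).uOf Z t φ) i j) {σ | ∀ j, σ j ∈ ι.Uσ}) ∧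
            (∀ σ : TPt (F.P k).d (domCount (F.P k) θ.τ9.M (m + 1)) → ℂ, (∀ j, σ j ∈ ι.Uσ) →
              ∀ i j, DifferentiableOn ℂ (fun φ => (𝔇 k m).A Z t φ σ i j) (big k (m + 1) Z)) ∧
            (∀ σ : TPt (F.P k).d (domCount (F.P k) θ.τ9.M (m + 1)) → ℂ, (∀ j, σ j ∈ ι.Uσ) →
              ∀ i j, DifferentiableOn ℂ (fun φ => ((𝔇 k m).𝒦 Z t).G2 σ ((𝔇 k m).uOf Z t φ) i j) (big k (m + 1) Z)) ∧
            (∀ Y B, DifferentiableOn ℂ (fun φ => (𝔇 k m).𝒱 Z t s old φ Y B) (big k (m + 1) Z)) ∧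
            (∀ φ ∈ big k (m + 1) Z, ∀ Y, Measurable ((𝔇 k m).𝒱 Z t s old φ Y)) ∧
            (∀ φ ∈ big k (m + 1) Z, ∀ σ : TPt (F.P k).d (domCount (F.P k) θ.τ9.M (m + 1)) → ℂ, (∀ j, σ j ∈ ι.Uσ) → ((𝔇 k m).A Z t φ σ).IsSymm) ∧
            (∀ φ ∈ big k (m + 1) Z, ∀ σ : TPt (F.P k).d (domCount (F.P k) θ.τ9.M (m + 1)) → ℂ, (∀ j, σ j ∈ ι.Uσ) →
              (((𝔇 k m).A Z t φ σ).map Complex.re).PosDef) ∧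
            (∀ φ ∈ big k (m + 1) Z, ∀ τ : TDom (F.P k).d ((L k) * domCount (F.P k) θ.τ9.M (m + 1)) → ℂ, (∀ Y, τ Y ∈ ι.Uτ Y) →
              ∀ B, ∑ Y ∈ t.1, ‖τ Y‖ * ‖(𝔇 k m).𝒱 Z t s old φ Y B‖ ≤ ι.a₂₀ / 2 * (B ⬝ᵥ B) + ι.w) ∧
            (∀ φ ∈ big k (m + 1) Z, ∀ σ : TPt (F.P k).d (domCount (F.P k) θ.τ9.M (m + 1)) → ℂ, (∀ j, σ j ∈ ι.Uσ) →
              ∀ b j, ‖((𝔇 k m).𝒦 Z t).G2 σ ((𝔇 k m).uOf Z t φ) b j‖ ≤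
                ι.KG * Real.exp (-(ι.kap * tdist1 (𝔇 k m).Nf (((𝔇 k m).𝒦 Z t).locΛ b) (((𝔇 k m).𝒦 Z t).locN j)))) ∧
            (∀ φ ∈ big k (m + 1) Z, ∀ σ : TPt (F.P k).d (domCount (F.P k) θ.τ9.M (m + 1)) → ℂ, (∀ j, σ j ∈ ι.Uσ) →
              ∀ b b', ‖((𝔇 k m).A Z t φ σ)⁻¹ b b'‖ ≤
                ι.KCs * Real.exp (-(ι.kap * tdist1 (𝔇 k m).Nf (((𝔇 k m).𝒦 Z t).locΛ b) (((𝔇 k m).𝒦 Z t).locΛ b')))) ∧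
            (∀ φ ∈ big k (m + 1) Z, ∀ σ : TPt (F.P k).d (domCount (F.P k) θ.τ9.M (m + 1)) → ℂ, (∀ j, σ j ∈ ι.Uσ) →
              ∀ b j, ‖(((𝔇 k m).𝒦 Z t).G2 σ ((𝔇 k m).uOf Z t φ) - ((𝔇 k m).𝒦 Z t).Γ₀.map (algebraMap ℝ ℂ)) b j‖ ≤
                ι.θΓ * Real.exp (-(ι.kap * tdist1 (𝔇 k m).Nf (((𝔇 k m).𝒦 Z t).locΛ b) (((𝔇 k m).𝒦 Z t).locN j)))) ∧
            (∀ φ ∈ big k (m + 1) Z, ∀ σ : TPt (F.P k).d (domCount (F.P k) θ.τ9.M (m + 1)) → ℂ, (∀ j, σ j ∈ ι.Uσ) →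
              ∀ b b', ‖(((𝔇 k m).A Z t φ σ)⁻¹ - ((𝔇 k m).𝒦 Z t).C.map (algebraMap ℝ ℂ)) b b'‖ ≤
                ι.θC * Real.exp (-(ι.kap * tdist1 (𝔇 k m).Nf (((𝔇 k m).𝒦 Z t).locΛ b) (((𝔇 k m).𝒦 Z t).locΛ b')))) ∧
            (∀ φ ∈ big k (m + 1) Z, ∀ σ : TPt (F.P k).d (domCount (F.P k) θ.τ9.M (m + 1)) → ℂ, (∀ j, σ j ∈ ι.Uσ) →
              ∀ b b', ‖((𝔇 k m).A Z t φ σ - ((𝔇 k m).𝒦 Z t).C⁻¹.map (algebraMap ℝ ℂ)) b b'‖ ≤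
                ι.θE * Real.exp (-(ι.kap * tdist1 (𝔇 k m).Nf (((𝔇 k m).𝒦 Z t).locΛ b) (((𝔇 k m).𝒦 Z t).locΛ b'))))) ∧
        0 ≤ (c k).C3act * (c k).ε₁ ∧ (c k).C3act * (c k).ε₁ ≤ A_A ∧
        Rd ≤ (1 - 8 * (c k).δ) * (((c k).L : ℝ) / 2) * (c k).κ ∧
        A_A * Real.exp (5 * κ + 1) * K₀ 64 8 * 9 * 64 < 1 ∧ Real.exp 1 * 9 * 64 * K₀ 64 8 ^ 2 * A_A ≤ E_A ∧
        -- (ii-B) level `(k + 1)`: tables ⊆ OPEN located-inputs tables, socket numerals of `c (k + 1)`, ONE located-inputs record per table point (file 32's `hloc`), domination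
        (∀ m, SpRestr (sp (k + 1) (m + 1))) ∧
        (∀ (m : ℕ) (Z : (domSys (F.P (k + 1)) θ.τ9.M (m + 1)).Dom), IsOpen (big (k + 1) (m + 1) Z)) ∧
        (∀ (m : ℕ) (Z : (domSys (F.P (k + 1)) θ.τ9.M (m + 1)).Dom), sp (k + 1) (m + 1) Z ⊆ big (k + 1) (m + 1) Z) ∧
        1 ≤ (c (k + 1)).κ₁ ∧ (c (k + 1)).α₆ ≠ 0 ∧ 8 ≤ (c (k + 1)).L ∧ (c (k + 1)).L = L (k + 1) ∧
        Lemma3Numerics (c (k + 1)) θ.τ9.M (((c (k + 1)).L : ℝ) / 2) aB a₂B a₂B' a₅B AabsB ∧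
        (∀ m : ℕ, ∀ s ∈ D, ∀ old : OlderTerms (F.P (k + 1)) (MatA N) θ.τ9.M m,
          (∀ (j : Fin (m + 1)) (Y : (domSys (F.P (k + 1)) θ.τ9.M j).Dom), ∀ ψ ∈ sp (k + 1) j Y, ‖old j Y ψ‖ ≤ E_B * Real.exp (-(κ * (domSys (F.P (k + 1)) θ.τ9.M j).dj Y))) →
          (∀ (j : Fin (m + 1)) (Y : (domSys (F.P (k + 1)) θ.τ9.M j).Dom), AnalyticOnNhd ℂ (old j Y) (sp (k + 1) j Y)) →
          ∀ (Z : (domSys (F.P (k + 1)) θ.τ9.M (m + 1)).Dom), ∀ t ∈ terms (L (k + 1)) θ.τ9.M Z, ∀ φ₁ ∈ big (k + 1) (m + 1) Z,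
            ∃ ι : (𝔇 (k + 1) m).Inputs226Holo (c (k + 1)) Z t s old φ₁ aB a₅B,
            (∀ φ ∈ big (k + 1) (m + 1) Z, ∀ i j, DifferentiableOn ℂ (fun σ => (𝔇 (k + 1) m).A Z t φ σ i j) {σ | ∀ j, σ j ∈ ι.Uσ}) ∧
            (∀ φ ∈ big (k + 1) (m + 1) Z, ∀ i j, DifferentiableOn ℂ (fun σ => ((𝔇 (k + 1) m).𝒦 Z t).G2 σ ((𝔇 (k + 1) m).uOf Z t φ) i j) {σ | ∀ j, σ j ∈ ι.Uσ}) ∧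
            (∀ σ : TPt (F.P (k + 1)).d (domCount (F.P (k + 1)) θ.τ9.M (m + 1)) → ℂ, (∀ j, σ j ∈ ι.Uσ) →
              ∀ i j, DifferentiableOn ℂ (fun φ => (𝔇 (k + 1) m).A Z t φ σ i j) (big (k + 1) (m + 1) Z)) ∧
            (∀ σ : TPt (F.P (k + 1)).d (domCount (F.P (k + 1)) θ.τ9.M (m + 1)) → ℂ, (∀ j, σ j ∈ ι.Uσ) →
              ∀ i j, DifferentiableOn ℂ (fun φ => ((𝔇 (k + 1) m).𝒦 Z t).G2 σ ((𝔇 (k + 1) m).uOf Z t φ) i j) (big (k + 1) (m + 1) Z)) ∧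
            (∀ Y B, DifferentiableOn ℂ (fun φ => (𝔇 (k + 1) m).𝒱 Z t s old φ Y B) (big (k + 1) (m + 1) Z)) ∧
            (∀ φ ∈ big (k + 1) (m + 1) Z, ∀ Y, Measurable ((𝔇 (k + 1) m).𝒱 Z t s old φ Y)) ∧
            (∀ φ ∈ big (k + 1) (m + 1) Z, ∀ σ : TPt (F.P (k + 1)).d (domCount (F.P (k + 1)) θ.τ9.M (m + 1)) → ℂ, (∀ j, σ j ∈ ι.Uσ) → ((𝔇 (k + 1) m).A Z t φ σ).IsSymm) ∧
            (∀ φ ∈ big (k + 1) (m + 1) Z, ∀ σ : TPt (F.P (k + 1)).d (domCount (F.P (k + 1)) θ.τ9.M (m + 1)) → ℂ, (∀ j, σ j ∈ ι.Uσ) →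
              (((𝔇 (k + 1) m).A Z t φ σ).map Complex.re).PosDef) ∧
            (∀ φ ∈ big (k + 1) (m + 1) Z, ∀ τ : TDom (F.P (k + 1)).d ((L (k + 1)) * domCount (F.P (k + 1)) θ.τ9.M (m + 1)) → ℂ, (∀ Y, τ Y ∈ ι.Uτ Y) →
              ∀ B, ∑ Y ∈ t.1, ‖τ Y‖ * ‖(𝔇 (k + 1) m).𝒱 Z t s old φ Y B‖ ≤ ι.a₂₀ / 2 * (B ⬝ᵥ B) + ι.w) ∧
            (∀ φ ∈ big (k + 1) (m + 1) Z, ∀ σ : TPt (F.P (k + 1)).d (domCount (F.P (k + 1)) θ.τ9.M (m + 1)) → ℂ, (∀ j, σ j ∈ ι.Uσ) →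
              ∀ b j, ‖((𝔇 (k + 1) m).𝒦 Z t).G2 σ ((𝔇 (k + 1) m).uOf Z t φ) b j‖ ≤
                ι.KG * Real.exp (-(ι.kap * tdist1 (𝔇 (k + 1) m).Nf (((𝔇 (k + 1) m).𝒦 Z t).locΛ b) (((𝔇 (k + 1) m).𝒦 Z t).locN j)))) ∧
            (∀ φ ∈ big (k + 1) (m + 1) Z, ∀ σ : TPt (F.P (k + 1)).d (domCount (F.P (k + 1)) θ.τ9.M (m + 1)) → ℂ, (∀ j, σ j ∈ ι.Uσ) →
              ∀ b b', ‖((𝔇 (k + 1) m).A Z t φ σ)⁻¹ b b'‖ ≤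
                ι.KCs * Real.exp (-(ι.kap * tdist1 (𝔇 (k + 1) m).Nf (((𝔇 (k + 1) m).𝒦 Z t).locΛ b) (((𝔇 (k + 1) m).𝒦 Z t).locΛ b')))) ∧
            (∀ φ ∈ big (k + 1) (m + 1) Z, ∀ σ : TPt (F.P (k + 1)).d (domCount (F.P (k + 1)) θ.τ9.M (m + 1)) → ℂ, (∀ j, σ j ∈ ι.Uσ) →
              ∀ b j, ‖(((𝔇 (k + 1) m).𝒦 Z t).G2 σ ((𝔇 (k + 1) m).uOf Z t φ) - ((𝔇 (k + 1) m).𝒦 Z t).Γ₀.map (algebraMap ℝ ℂ)) b j‖ ≤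
                ι.θΓ * Real.exp (-(ι.kap * tdist1 (𝔇 (k + 1) m).Nf (((𝔇 (k + 1) m).𝒦 Z t).locΛ b) (((𝔇 (k + 1) m).𝒦 Z t).locN j)))) ∧
            (∀ φ ∈ big (k + 1) (m + 1) Z, ∀ σ : TPt (F.P (k + 1)).d (domCount (F.P (k + 1)) θ.τ9.M (m + 1)) → ℂ, (∀ j, σ j ∈ ι.Uσ) →
              ∀ b b', ‖(((𝔇 (k + 1) m).A Z t φ σ)⁻¹ - ((𝔇 (k + 1) m).𝒦 Z t).C.map (algebraMap ℝ ℂ)) b b'‖ ≤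
                ι.θC * Real.exp (-(ι.kap * tdist1 (𝔇 (k + 1) m).Nf (((𝔇 (k + 1) m).𝒦 Z t).locΛ b) (((𝔇 (k + 1) m).𝒦 Z t).locΛ b')))) ∧
            (∀ φ ∈ big (k + 1) (m + 1) Z, ∀ σ : TPt (F.P (k + 1)).d (domCount (F.P (k + 1)) θ.τ9.M (m + 1)) → ℂ, (∀ j, σ j ∈ ι.Uσ) →
              ∀ b b', ‖((𝔇 (k + 1) m).A Z t φ σ - ((𝔇 (k + 1) m).𝒦 Z t).C⁻¹.map (algebraMap ℝ ℂ)) b b'‖ ≤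
                ι.θE * Real.exp (-(ι.kap * tdist1 (𝔇 (k + 1) m).Nf (((𝔇 (k + 1) m).𝒦 Z t).locΛ b) (((𝔇 (k + 1) m).𝒦 Z t).locΛ b'))))) ∧
        0 ≤ (c (k + 1)).C3act * (c (k + 1)).ε₁ ∧ (c (k + 1)).C3act * (c (k + 1)).ε₁ ≤ A_B ∧
        Rd ≤ (1 - 8 * (c (k + 1)).δ) * (((c (k + 1)).L : ℝ) / 2) * (c (k + 1)).κ ∧
        A_B * Real.exp (5 * κ + 1) * K₀ 64 8 * 9 * 64 < 1 ∧ Real.exp 1 * 9 * 64 * K₀ 64 8 ^ 2 * A_B ≤ E_B ∧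
        (∀ s ∈ Ioc (0 : ℝ) γ', ((s : ℝ) : ℂ) ∈ D) ∧
        -- the reading's letters dominate the END's
        θ.γ ≤ γ' ∧ li.κ ≤ κ ∧ θ' ≤ li.θ₅ ∧
        (Real.exp 1 * 9 * 64 * K₀ 64 8 ^ 2 * (C3 * ε₁) / (1 - ρ₀) * (δ + δ') + B) * (θ' - ω) /
            (θ' - (ω + Real.exp 1 * 9 * 64 * K₀ 64 8 ^ 2 * (C3 * ε₁) / (1 - ρ₀) * cH)) ≤ li.C₅) :
    N18At (u3OfRecord₁₃ θ ((ReadingData.ofRecordAdm F θ.τ9.M N (runTowers fun k => toClusterTower ((𝔇 k).Gn)) sp gauge hg T₀ hT₀ li).u3Objects θ.γ)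
      k) := by
  obtain ⟨Op, iO₁, iO₂, Hist, iH₁, iH₂, Mb, act, γ', C3, ε₁, Rd, κ, A_A, A_B, E_A, E_B, E₁, δ, δ', θr, θ', cH, ω, ρ₀, B, k₀,
    aA, a₂A, a₂A', a₅A, AabsA, aB, a₂B, a₂B', a₅B, AabsB, hrep, hC3, hε₁, hκ, hrate,
    hKP, hH, l01, l02, l03, l07, l08, l09aff, l09blind, l09hom, l09unit, hE₁, hδ, hθ, hθθ', hθ'1, hcH, hω, hρ₀, l10near, hB, l10first, hS,
    hrestrA, hbigoA, hbigA, hκ₁A, hα₆A, hL8A, hLcA, hNA, hlocA, hposA, hAleA, hRdA, hsmallA, hrenewA,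
    hrestrB, hbigoB, hbigB, hκ₁B, hα₆B, hL8B, hLcB, hNB, hlocB, hposB, hAleB, hRdB, hsmallB, hrenewB, hD, hγ, hℓκ, hℓθ, hℓC⟩ := h
  -- (GEN) for the datum's generators at the two levels, from the table-based records (file 32), all steps
  have hgenA := stepGen_Gn_of_inputs226Holo F k (L k) (𝔇 k) D (sp k) (big k) hbigoA hκ₁A hα₆A hlocA hL8A hLcA hNA hbigA
  have hgenB := stepGen_Gn_of_inputs226Holo F (k + 1) (L (k + 1)) (𝔇 (k + 1)) D (sp (k + 1)) (big (k + 1)) hbigoB hκ₁B hα₆B hlocB hL8B hLcB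
    hNB hbigB
  exact n18At_u3OfRecord₁₃_readingAdm_runTowers_toClusterTower_of_stepGen_lt θ k (fun k => (𝔇 k).Gn) D sp gauge hg T₀ hT₀ li
    ⟨Op, iO₁, iO₂, Hist, iH₁, iH₂, Mb, act, γ', C3, ε₁, Rd, κ, A_A, A_B, E_A, E_B, E₁, δ, δ', θr, θ', cH, ω, ρ₀, B, k₀, hrep, hC3, hε₁, hκ,
      hrate, hKP, hH, l01, l02, l03, l07, l08, l09aff, l09blind, l09hom, l09unit, hE₁, hδ, hθ, hθθ', hθ'1, hcH, hω, hρ₀, l10near, hB,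
      l10first, hS, hrestrA,
      fun m _ t ht old hBd hAn =>
        ⟨(hgenA m t ht old hBd hAn).1, fun Z φ hφ =>
          norm_le_of_le_amplitude_rate ((hgenA m t ht old hBd hAn).2 Z φ hφ) hposA hAleA hRdA
            ((domSys (F.P k) θ.τ9.M (m + 1)).dj_nonneg Z)⟩,
      hposA.trans hAleA, hsmallA, hrenewA, hrestrB,
      fun m _ t ht old hBd hAn =>
        ⟨(hgenB m t ht old hBd hAn).1, fun Z φ hφ =>
          norm_le_of_le_amplitude_rate ((hgenB m t ht old hBd hAn).2 Z φ hφ) hposB hAleB hRdB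
            ((domSys (F.P (k + 1)) θ.τ9.M (m + 1)).dj_nonneg Z)⟩,
      hposB.trans hAleB, hsmallB, hrenewB, hD, hγ, hℓκ, hℓθ, hℓC⟩

open Classical in
/-- ★ **THE SAME AT W1-9's TOTAL GENERATOR — N18 FOR THE RUN TOWERS `runTowers (k ↦ toClusterTower ((𝔇 k).Gn₀))`** (the tower family dag-n22-c's R2c
`n22_tupleReadingOfRecordSep[On]_relCentredTermDatum₀_of_n18Below` and its `Co` twin read in `h18`, per `k' < ksel`) [bookkeeping;
`n18At_u3OfRecord₁₃_readingAdm_runTowers_Gn_of_inputs226Holo` transported along `TermData214.Gn₀_apply_eq : (𝔇 k).Gn₀ = (𝔇 k).Gn` under the tuple's positive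
cube size]: hypotheses (i)–(iii) of the `Gn` edition, stated at the total generator, ⟹ `N18At` at node U3's Stage-13 bundle of level `k` for the LITERALLY
GENERATED run towers of the term-datum family.  NOT a discharge of N18; every datum is a hypothesis.
[cite: Balaban1987RG1, (0.23)–(0.25) pp.256–257, Thm 1 p.259, (1.18) p.263 and (2.12)–(2.13) p.268; Balaban1988RG2Cluster, (1.41) p.11, (2.9)–(2.11) p.14, (2.13)–(2.15) pp.14–15, (2.26) p.17, Lemma 3 (2.38) p.20] -/
theorem n18At_u3OfRecord₁₃_readingAdm_runTowers_Gn₀_of_inputs226Holo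
    (h : ∃ (Op : Type) (_ : NormedAddCommGroup Op) (_ : NormedSpace ℂ Op) (Hist : Type) (_ : NormedAddCommGroup Hist) (_ : NormedSpace ℂ Hist)
        (Mb : ℝ → StepModel (LevelPairing.ofRecordAdm F θ.τ9.M N k sp (gauge k) (hg k) (T₀ k) (hT₀ k)).carriers Op Hist)
        (act : ℝ → (j : ℕ) → Op × Hist → TDom 4 (domCount (F.P k) θ.τ9.M j) → ℂ) (γ' C3 ε₁ Rd κ A_A A_B E_A E_B E₁ δ δ' θr θ' cH ω ρ₀ B : ℝ) (k₀ : ℕ)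
        (aA a₂A a₂A' a₅A AabsA aB a₂B a₂B' a₅B AabsB : ℝ),
        (∀ b : ℝ, 0 < b → b ≤ γ' → ∀ (X : Node00.W1.Dom (F.P k) θ.τ9.M) (z : Op × Hist),
          (Mb b).Out X.1 z.1 z.2 X =
            locE (TTouch (d := 4) (N := domCount (F.P k) θ.τ9.M X.1)) (fun Z : (tsys 4 (domCount (F.P k) θ.τ9.M X.1)).Dom => Z.1)
              (act b X.1 z) X.2.1) ∧
        0 ≤ C3 ∧ 0 ≤ ε₁ ∧ 0 ≤ κ ∧ κ + 2 * (64 * Real.log 162) + 2 ≤ Rd ∧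
        C3 * ε₁ * Real.exp (5 * κ + 1) * K₀ 64 8 * 9 * 64 ≤ 1 ∧
        (∀ b : ℝ, 0 < b → b ≤ γ' → ∀ j, ∀ g ∈ Window γ',
          ∀ (U : (LevelPairing.ofRecordAdm F θ.τ9.M N k sp (gauge k) (hg k) (T₀ k) (hT₀ k)).BgB) (q : Op × Hist), q ∈ (Mb b).Base j g U →
          ∃ V : Set (Op × Hist), IsOpen V ∧ (Mb b).box j q ⊆ V ∧
            (∀ Z : TDom 4 (domCount (F.P k) θ.τ9.M j), DifferentiableOn ℂ (fun z : Op × Hist => act b j z Z) V) ∧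
            (∀ z ∈ V, ∀ Z : TDom 4 (domCount (F.P k) θ.τ9.M j), ‖act b j z Z‖ ≤ C3 * ε₁ * Real.exp (-(Rd * torusTreeLen Z.1)))) ∧
        (∀ b : ℝ, 0 < b → b ≤ γ' → L01 (Mb b)
          ((LevelPairing.ofRecordAdm F θ.τ9.M N k sp (gauge k) (hg k) (T₀ k) (hT₀ k)).EA (runTowers (fun k => toClusterTower ((𝔇 k).Gn₀)) k)) (Window γ')) ∧
        (∀ b : ℝ, 0 < b → b ≤ γ' → L02 (Mb b)
          ((LevelPairing.ofRecordAdm F θ.τ9.M N k sp (gauge k) (hg k) (T₀ k) (hT₀ k)).EB (runTowers (fun k => toClusterTower ((𝔇 k).Gn₀)) (k + 1)) b) (Window γ')) ∧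
        (∀ b : ℝ, 0 < b → b ≤ γ' → L03 (Mb b)
          ((LevelPairing.ofRecordAdm F θ.τ9.M N k sp (gauge k) (hg k) (T₀ k) (hT₀ k)).EB (runTowers (fun k => toClusterTower ((𝔇 k).Gn₀)) (k + 1)) b) (Window γ')) ∧
        (∀ b : ℝ, 0 < b → b ≤ γ' → L07 (Mb b) (Window γ') δ θr) ∧
        (∀ b : ℝ, 0 < b → b ≤ γ' → L08 (Mb b) (Window γ') κ (Real.exp 1 * 9 * 64 * K₀ 64 8 ^ 2 * A_B) δ' θr) ∧
        (∀ b : ℝ, 0 < b → b ≤ γ' → L09aff (Mb b) (Window γ')) ∧ (∀ b : ℝ, 0 < b → b ≤ γ' → L09blind (Mb b) (Window γ')) ∧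
        (∀ b : ℝ, 0 < b → b ≤ γ' → L09hom (Mb b) (Window γ')) ∧ (∀ b : ℝ, 0 < b → b ≤ γ' → L09unit (Mb b) (Window γ') κ E₁ cH ω) ∧
        0 < E₁ ∧ 0 ≤ δ + δ' ∧ 0 ≤ θr ∧ θr ≤ θ' ∧ θ' ≤ 1 ∧ 0 ≤ cH ∧ 0 < ω ∧ ρ₀ < 1 ∧
        (δ + δ') * θr ^ k₀ +
            cH * (Real.exp 1 * 9 * 64 * K₀ 64 8 ^ 2 * A_A + Real.exp 1 * 9 * 64 * K₀ 64 8 ^ 2 * A_B) / (1 - ω) ≤ ρ₀ ∧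
        0 ≤ B ∧ (∀ k < k₀, Real.exp 1 * 9 * 64 * K₀ 64 8 ^ 2 * A_A + Real.exp 1 * 9 * 64 * K₀ 64 8 ^ 2 * A_B ≤ B * θr ^ k) ∧
        Real.exp 1 * 9 * 64 * K₀ 64 8 ^ 2 * C3 * cH * ε₁ < (θ' - ω) * (1 - ρ₀) ∧
        (∀ m, SpRestr (sp k (m + 1))) ∧
        (∀ (m : ℕ) (Z : (domSys (F.P k) θ.τ9.M (m + 1)).Dom), IsOpen (big k (m + 1) Z)) ∧
        (∀ (m : ℕ) (Z : (domSys (F.P k) θ.τ9.M (m + 1)).Dom), sp k (m + 1) Z ⊆ big k (m + 1) Z) ∧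
        1 ≤ (c k).κ₁ ∧ (c k).α₆ ≠ 0 ∧ 8 ≤ (c k).L ∧ (c k).L = L k ∧
        Lemma3Numerics (c k) θ.τ9.M (((c k).L : ℝ) / 2) aA a₂A a₂A' a₅A AabsA ∧
        (∀ m : ℕ, ∀ s ∈ D, ∀ old : OlderTerms (F.P k) (MatA N) θ.τ9.M m,
          (∀ (j : Fin (m + 1)) (Y : (domSys (F.P k) θ.τ9.M j).Dom), ∀ ψ ∈ sp k j Y, ‖old j Y ψ‖ ≤ E_A * Real.exp (-(κ * (domSys (F.P k) θ.τ9.M j).dj Y))) →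
          (∀ (j : Fin (m + 1)) (Y : (domSys (F.P k) θ.τ9.M j).Dom), AnalyticOnNhd ℂ (old j Y) (sp k j Y)) →
          ∀ (Z : (domSys (F.P k) θ.τ9.M (m + 1)).Dom), ∀ t ∈ terms (L k) θ.τ9.M Z, ∀ φ₁ ∈ big k (m + 1) Z,
            ∃ ι : (𝔇 k m).Inputs226Holo (c k) Z t s old φ₁ aA a₅A,
            (∀ φ ∈ big k (m + 1) Z, ∀ i j, DifferentiableOn ℂ (fun σ => (𝔇 k m).A Z t φ σ i j) {σ | ∀ j, σ j ∈ ι.Uσ}) ∧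
            (∀ φ ∈ big k (m + 1) Z, ∀ i j, DifferentiableOn ℂ (fun σ => ((𝔇 k m).𝒦 Z t).G2 σ ((𝔇 k m).uOf Z t φ) i j) {σ | ∀ j, σ j ∈ ι.Uσ}) ∧
            (∀ σ : TPt (F.P k).d (domCount (F.P k) θ.τ9.M (m + 1)) → ℂ, (∀ j, σ j ∈ ι.Uσ) →
              ∀ i j, DifferentiableOn ℂ (fun φ => (𝔇 k m).A Z t φ σ i j) (big k (m + 1) Z)) ∧
            (∀ σ : TPt (F.P k).d (domCount (F.P k) θ.τ9.M (m + 1)) → ℂ, (∀ j, σ j ∈ ι.Uσ) →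
              ∀ i j, DifferentiableOn ℂ (fun φ => ((𝔇 k m).𝒦 Z t).G2 σ ((𝔇 k m).uOf Z t φ) i j) (big k (m + 1) Z)) ∧
            (∀ Y B, DifferentiableOn ℂ (fun φ => (𝔇 k m).𝒱 Z t s old φ Y B) (big k (m + 1) Z)) ∧
            (∀ φ ∈ big k (m + 1) Z, ∀ Y, Measurable ((𝔇 k m).𝒱 Z t s old φ Y)) ∧
            (∀ φ ∈ big k (m + 1) Z, ∀ σ : TPt (F.P k).d (domCount (F.P k) θ.τ9.M (m + 1)) → ℂ, (∀ j, σ j ∈ ι.Uσ) → ((𝔇 k m).A Z t φ σ).IsSymm) ∧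
            (∀ φ ∈ big k (m + 1) Z, ∀ σ : TPt (F.P k).d (domCount (F.P k) θ.τ9.M (m + 1)) → ℂ, (∀ j, σ j ∈ ι.Uσ) →
              (((𝔇 k m).A Z t φ σ).map Complex.re).PosDef) ∧
            (∀ φ ∈ big k (m + 1) Z, ∀ τ : TDom (F.P k).d ((L k) * domCount (F.P k) θ.τ9.M (m + 1)) → ℂ, (∀ Y, τ Y ∈ ι.Uτ Y) →
              ∀ B, ∑ Y ∈ t.1, ‖τ Y‖ * ‖(𝔇 k m).𝒱 Z t s old φ Y B‖ ≤ ι.a₂₀ / 2 * (B ⬝ᵥ B) + ι.w) ∧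
            (∀ φ ∈ big k (m + 1) Z, ∀ σ : TPt (F.P k).d (domCount (F.P k) θ.τ9.M (m + 1)) → ℂ, (∀ j, σ j ∈ ι.Uσ) →
              ∀ b j, ‖((𝔇 k m).𝒦 Z t).G2 σ ((𝔇 k m).uOf Z t φ) b j‖ ≤
                ι.KG * Real.exp (-(ι.kap * tdist1 (𝔇 k m).Nf (((𝔇 k m).𝒦 Z t).locΛ b) (((𝔇 k m).𝒦 Z t).locN j)))) ∧
            (∀ φ ∈ big k (m + 1) Z, ∀ σ : TPt (F.P k).d (domCount (F.P k) θ.τ9.M (m + 1)) → ℂ, (∀ j, σ j ∈ ι.Uσ) →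
              ∀ b b', ‖((𝔇 k m).A Z t φ σ)⁻¹ b b'‖ ≤
                ι.KCs * Real.exp (-(ι.kap * tdist1 (𝔇 k m).Nf (((𝔇 k m).𝒦 Z t).locΛ b) (((𝔇 k m).𝒦 Z t).locΛ b')))) ∧
            (∀ φ ∈ big k (m + 1) Z, ∀ σ : TPt (F.P k).d (domCount (F.P k) θ.τ9.M (m + 1)) → ℂ, (∀ j, σ j ∈ ι.Uσ) →
              ∀ b j, ‖(((𝔇 k m).𝒦 Z t).G2 σ ((𝔇 k m).uOf Z t φ) - ((𝔇 k m).𝒦 Z t).Γ₀.map (algebraMap ℝ ℂ)) b j‖ ≤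
                ι.θΓ * Real.exp (-(ι.kap * tdist1 (𝔇 k m).Nf (((𝔇 k m).𝒦 Z t).locΛ b) (((𝔇 k m).𝒦 Z t).locN j)))) ∧
            (∀ φ ∈ big k (m + 1) Z, ∀ σ : TPt (F.P k).d (domCount (F.P k) θ.τ9.M (m + 1)) → ℂ, (∀ j, σ j ∈ ι.Uσ) →
              ∀ b b', ‖(((𝔇 k m).A Z t φ σ)⁻¹ - ((𝔇 k m).𝒦 Z t).C.map (algebraMap ℝ ℂ)) b b'‖ ≤
                ι.θC * Real.exp (-(ι.kap * tdist1 (𝔇 k m).Nf (((𝔇 k m).𝒦 Z t).locΛ b) (((𝔇 k m).𝒦 Z t).locΛ b')))) ∧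
            (∀ φ ∈ big k (m + 1) Z, ∀ σ : TPt (F.P k).d (domCount (F.P k) θ.τ9.M (m + 1)) → ℂ, (∀ j, σ j ∈ ι.Uσ) →
              ∀ b b', ‖((𝔇 k m).A Z t φ σ - ((𝔇 k m).𝒦 Z t).C⁻¹.map (algebraMap ℝ ℂ)) b b'‖ ≤
                ι.θE * Real.exp (-(ι.kap * tdist1 (𝔇 k m).Nf (((𝔇 k m).𝒦 Z t).locΛ b) (((𝔇 k m).𝒦 Z t).locΛ b'))))) ∧
        0 ≤ (c k).C3act * (c k).ε₁ ∧ (c k).C3act * (c k).ε₁ ≤ A_A ∧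
        Rd ≤ (1 - 8 * (c k).δ) * (((c k).L : ℝ) / 2) * (c k).κ ∧
        A_A * Real.exp (5 * κ + 1) * K₀ 64 8 * 9 * 64 < 1 ∧ Real.exp 1 * 9 * 64 * K₀ 64 8 ^ 2 * A_A ≤ E_A ∧
        (∀ m, SpRestr (sp (k + 1) (m + 1))) ∧
        (∀ (m : ℕ) (Z : (domSys (F.P (k + 1)) θ.τ9.M (m + 1)).Dom), IsOpen (big (k + 1) (m + 1) Z)) ∧
        (∀ (m : ℕ) (Z : (domSys (F.P (k + 1)) θ.τ9.M (m + 1)).Dom), sp (k + 1) (m + 1) Z ⊆ big (k + 1) (m + 1) Z) ∧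
        1 ≤ (c (k + 1)).κ₁ ∧ (c (k + 1)).α₆ ≠ 0 ∧ 8 ≤ (c (k + 1)).L ∧ (c (k + 1)).L = L (k + 1) ∧
        Lemma3Numerics (c (k + 1)) θ.τ9.M (((c (k + 1)).L : ℝ) / 2) aB a₂B a₂B' a₅B AabsB ∧
        (∀ m : ℕ, ∀ s ∈ D, ∀ old : OlderTerms (F.P (k + 1)) (MatA N) θ.τ9.M m,
          (∀ (j : Fin (m + 1)) (Y : (domSys (F.P (k + 1)) θ.τ9.M j).Dom), ∀ ψ ∈ sp (k + 1) j Y, ‖old j Y ψ‖ ≤ E_B * Real.exp (-(κ * (domSys (F.P (k + 1)) θ.τ9.M j).dj Y))) →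
          (∀ (j : Fin (m + 1)) (Y : (domSys (F.P (k + 1)) θ.τ9.M j).Dom), AnalyticOnNhd ℂ (old j Y) (sp (k + 1) j Y)) →
          ∀ (Z : (domSys (F.P (k + 1)) θ.τ9.M (m + 1)).Dom), ∀ t ∈ terms (L (k + 1)) θ.τ9.M Z, ∀ φ₁ ∈ big (k + 1) (m + 1) Z,
            ∃ ι : (𝔇 (k + 1) m).Inputs226Holo (c (k + 1)) Z t s old φ₁ aB a₅B,
            (∀ φ ∈ big (k + 1) (m + 1) Z, ∀ i j, DifferentiableOn ℂ (fun σ => (𝔇 (k + 1) m).A Z t φ σ i j) {σ | ∀ j, σ j ∈ ι.Uσ}) ∧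
            (∀ φ ∈ big (k + 1) (m + 1) Z, ∀ i j, DifferentiableOn ℂ (fun σ => ((𝔇 (k + 1) m).𝒦 Z t).G2 σ ((𝔇 (k + 1) m).uOf Z t φ) i j) {σ | ∀ j, σ j ∈ ι.Uσ}) ∧
            (∀ σ : TPt (F.P (k + 1)).d (domCount (F.P (k + 1)) θ.τ9.M (m + 1)) → ℂ, (∀ j, σ j ∈ ι.Uσ) →
              ∀ i j, DifferentiableOn ℂ (fun φ => (𝔇 (k + 1) m).A Z t φ σ i j) (big (k + 1) (m + 1) Z)) ∧
            (∀ σ : TPt (F.P (k + 1)).d (domCount (F.P (k + 1)) θ.τ9.M (m + 1)) → ℂ, (∀ j, σ j ∈ ι.Uσ) →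
              ∀ i j, DifferentiableOn ℂ (fun φ => ((𝔇 (k + 1) m).𝒦 Z t).G2 σ ((𝔇 (k + 1) m).uOf Z t φ) i j) (big (k + 1) (m + 1) Z)) ∧
            (∀ Y B, DifferentiableOn ℂ (fun φ => (𝔇 (k + 1) m).𝒱 Z t s old φ Y B) (big (k + 1) (m + 1) Z)) ∧
            (∀ φ ∈ big (k + 1) (m + 1) Z, ∀ Y, Measurable ((𝔇 (k + 1) m).𝒱 Z t s old φ Y)) ∧
            (∀ φ ∈ big (k + 1) (m + 1) Z, ∀ σ : TPt (F.P (k + 1)).d (domCount (F.P (k + 1)) θ.τ9.M (m + 1)) → ℂ, (∀ j, σ j ∈ ι.Uσ) → ((𝔇 (k + 1) m).A Z t φ σ).IsSymm) ∧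
            (∀ φ ∈ big (k + 1) (m + 1) Z, ∀ σ : TPt (F.P (k + 1)).d (domCount (F.P (k + 1)) θ.τ9.M (m + 1)) → ℂ, (∀ j, σ j ∈ ι.Uσ) →
              (((𝔇 (k + 1) m).A Z t φ σ).map Complex.re).PosDef) ∧
            (∀ φ ∈ big (k + 1) (m + 1) Z, ∀ τ : TDom (F.P (k + 1)).d ((L (k + 1)) * domCount (F.P (k + 1)) θ.τ9.M (m + 1)) → ℂ, (∀ Y, τ Y ∈ ι.Uτ Y) →
              ∀ B, ∑ Y ∈ t.1, ‖τ Y‖ * ‖(𝔇 (k + 1) m).𝒱 Z t s old φ Y B‖ ≤ ι.a₂₀ / 2 * (B ⬝ᵥ B) + ι.w) ∧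
            (∀ φ ∈ big (k + 1) (m + 1) Z, ∀ σ : TPt (F.P (k + 1)).d (domCount (F.P (k + 1)) θ.τ9.M (m + 1)) → ℂ, (∀ j, σ j ∈ ι.Uσ) →
              ∀ b j, ‖((𝔇 (k + 1) m).𝒦 Z t).G2 σ ((𝔇 (k + 1) m).uOf Z t φ) b j‖ ≤
                ι.KG * Real.exp (-(ι.kap * tdist1 (𝔇 (k + 1) m).Nf (((𝔇 (k + 1) m).𝒦 Z t).locΛ b) (((𝔇 (k + 1) m).𝒦 Z t).locN j)))) ∧
            (∀ φ ∈ big (k + 1) (m + 1) Z, ∀ σ : TPt (F.P (k + 1)).d (domCount (F.P (k + 1)) θ.τ9.M (m + 1)) → ℂ, (∀ j, σ j ∈ ι.Uσ) →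
              ∀ b b', ‖((𝔇 (k + 1) m).A Z t φ σ)⁻¹ b b'‖ ≤
                ι.KCs * Real.exp (-(ι.kap * tdist1 (𝔇 (k + 1) m).Nf (((𝔇 (k + 1) m).𝒦 Z t).locΛ b) (((𝔇 (k + 1) m).𝒦 Z t).locΛ b')))) ∧
            (∀ φ ∈ big (k + 1) (m + 1) Z, ∀ σ : TPt (F.P (k + 1)).d (domCount (F.P (k + 1)) θ.τ9.M (m + 1)) → ℂ, (∀ j, σ j ∈ ι.Uσ) →
              ∀ b j, ‖(((𝔇 (k + 1) m).𝒦 Z t).G2 σ ((𝔇 (k + 1) m).uOf Z t φ) - ((𝔇 (k + 1) m).𝒦 Z t).Γ₀.map (algebraMap ℝ ℂ)) b j‖ ≤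
                ι.θΓ * Real.exp (-(ι.kap * tdist1 (𝔇 (k + 1) m).Nf (((𝔇 (k + 1) m).𝒦 Z t).locΛ b) (((𝔇 (k + 1) m).𝒦 Z t).locN j)))) ∧
            (∀ φ ∈ big (k + 1) (m + 1) Z, ∀ σ : TPt (F.P (k + 1)).d (domCount (F.P (k + 1)) θ.τ9.M (m + 1)) → ℂ, (∀ j, σ j ∈ ι.Uσ) →
              ∀ b b', ‖(((𝔇 (k + 1) m).A Z t φ σ)⁻¹ - ((𝔇 (k + 1) m).𝒦 Z t).C.map (algebraMap ℝ ℂ)) b b'‖ ≤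
                ι.θC * Real.exp (-(ι.kap * tdist1 (𝔇 (k + 1) m).Nf (((𝔇 (k + 1) m).𝒦 Z t).locΛ b) (((𝔇 (k + 1) m).𝒦 Z t).locΛ b')))) ∧
            (∀ φ ∈ big (k + 1) (m + 1) Z, ∀ σ : TPt (F.P (k + 1)).d (domCount (F.P (k + 1)) θ.τ9.M (m + 1)) → ℂ, (∀ j, σ j ∈ ι.Uσ) →
              ∀ b b', ‖((𝔇 (k + 1) m).A Z t φ σ - ((𝔇 (k + 1) m).𝒦 Z t).C⁻¹.map (algebraMap ℝ ℂ)) b b'‖ ≤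
                ι.θE * Real.exp (-(ι.kap * tdist1 (𝔇 (k + 1) m).Nf (((𝔇 (k + 1) m).𝒦 Z t).locΛ b) (((𝔇 (k + 1) m).𝒦 Z t).locΛ b'))))) ∧
        0 ≤ (c (k + 1)).C3act * (c (k + 1)).ε₁ ∧ (c (k + 1)).C3act * (c (k + 1)).ε₁ ≤ A_B ∧
        Rd ≤ (1 - 8 * (c (k + 1)).δ) * (((c (k + 1)).L : ℝ) / 2) * (c (k + 1)).κ ∧
        A_B * Real.exp (5 * κ + 1) * K₀ 64 8 * 9 * 64 < 1 ∧ Real.exp 1 * 9 * 64 * K₀ 64 8 ^ 2 * A_B ≤ E_B ∧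
        (∀ s ∈ Ioc (0 : ℝ) γ', ((s : ℝ) : ℂ) ∈ D) ∧
        θ.γ ≤ γ' ∧ li.κ ≤ κ ∧ θ' ≤ li.θ₅ ∧
        (Real.exp 1 * 9 * 64 * K₀ 64 8 ^ 2 * (C3 * ε₁) / (1 - ρ₀) * (δ + δ') + B) * (θ' - ω) /
            (θ' - (ω + Real.exp 1 * 9 * 64 * K₀ 64 8 ^ 2 * (C3 * ε₁) / (1 - ρ₀) * cH)) ≤ li.C₅) :
    N18At (u3OfRecord₁₃ θ ((ReadingData.ofRecordAdm F θ.τ9.M N (runTowers fun k => toClusterTower ((𝔇 k).Gn₀)) sp gauge hg T₀ hT₀ li).u3Objects θ.γ)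
      k) := by
  have hG : (fun k => toClusterTower ((𝔇 k).Gn₀ (L := L k))) = fun k => toClusterTower ((𝔇 k).Gn (L := L k)) :=
    funext fun k => by rw [TermData214.Gn₀_eq]
  rw [hG] at h ⊢
  exact n18At_u3OfRecord₁₃_readingAdm_runTowers_Gn_of_inputs226Holo θ k c L 𝔇 D sp big gauge hg T₀ hT₀ li h

end Level

end Summit.QuantumFields.YangMills.BalabanUVNodes.N18AtTermDatumInputs226

end
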